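import Mathlib
import Summits.Ventures.PercRepro2.TriDisagreementPinned

/-!
# Factorisation of typed counts over disjoint typed-edge sets (blind cell PercRepro2, night-3 g5,
2026-08-25; `proofs/NIGHT3-CERT.md` §14.4, the Lean tool for the separated class)

A typed triple on `A ∪ B` (`A`, `B` disjoint) is the merge of a typed triple on `A` and a typed
triple on `B` over the common background `z` (`merge` / `restr`, `sum_merge`).  Hence the typed
count of a PRODUCT kernel — a kernel of the form `K_A (x|A) (y|A) (w|A) · K_B (x|B) (y|B) (w|B)`,
each factor seeing only its own typed edges — factorises:

  **`typedCount_mul_of_disjoint`**: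
  `typedCount (A ∪ B) z τ (K_A ∘ restr A ⊗ K_B ∘ restr B) = typedCount A z τ K_A · typedCount B z τ K_B`.

This is the algebraic half of the separated-class theorem (§14.4): when `a₁ ↮ a₂` in `z ∪ F`, the
state of a copy splits into an `l`-side part (a function of the typed edges at the component of
`a₁`) and an `h`-side part, every term of `K₃` is a product kernel, and the count becomes
`2 · A_H · (S_same − S_cross)`.
-/

namespace Summit.Ventures.PercRepro2

namespace CovForm

namespace TypedFactor

section Merge

variable {E : Type*} [DecidableEq E]

/-- The restriction of a configuration to the edge set `A` over the background `z`. -/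
def restr (A : Finset E) (z x : Config E) : Config E := fun e => if e ∈ A then x e else z e

/-- The merge of two configurations over `A`, `B` with background `z`. -/
def merge (A B : Finset E) (z x y : Config E) : Config E :=
  fun e => if e ∈ A then x e else if e ∈ B then y e else z e

/-- `restr` on `A` is the configuration. -/
lemma restr_of_mem {A : Finset E} {z x : Config E} {e : E} (he : e ∈ A) : restr A z x e = x e := by
  simp [restr, he]

/-- `restr` off `A` is the background. -/
lemma restr_of_not_mem {A : Finset E} {z x : Config E} {e : E} (he : e ∉ A) :
    restr A z x e = z e := by
  simp [restr, he]

/-- Restricting a merge to `A` recovers the first configuration (when it is `z` off `A`). -/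
lemma restr_merge_left {A B : Finset E} {z x y : Config E}
    (hx : ∀ e, e ∉ A → x e = z e) : restr A z (merge A B z x y) = x := by
  funext e
  by_cases he : e ∈ A
  · simp [restr, merge, he]
  · simp [restr, he, hx e he]

/-- Restricting a merge to `B` recovers the second configuration (when it is `z` off `B`). -/
lemma restr_merge_right {A B : Finset E} (hAB : Disjoint A B) {z x y : Config E}
    (hy : ∀ e, e ∉ B → y e = z e) : restr B z (merge A B z x y) = y := by
  funext e
  by_cases he : e ∈ B
  · have heA : e ∉ A := fun h => Finset.disjoint_left.1 hAB h he
    simp [restr, merge, he, heA]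
  · simp [restr, he, hy e he]

/-- A configuration agreeing with `z` off `A ∪ B` is the merge of its restrictions. -/
lemma merge_restr {A B : Finset E} {z x : Config E} (hx : ∀ e, e ∉ A ∪ B → x e = z e) :
    merge A B z (restr A z x) (restr B z x) = x := by
  funext e
  by_cases heA : e ∈ A
  · simp [merge, restr, heA]
  · by_cases heB : e ∈ B
    · simp [merge, restr, heA, heB]
    · have : e ∉ A ∪ B := by simp [heA, heB]
      simp [merge, heA, heB, hx e this]

/-- A merge agrees with the background off `A ∪ B`. -/
lemma merge_agree {A B : Finset E} {z x y : Config E} (e : E) (he : e ∉ A ∪ B) :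
    merge A B z x y e = z e := by
  have heA : e ∉ A := fun h => he (Finset.mem_union_left _ h)
  have heB : e ∉ B := fun h => he (Finset.mem_union_right _ h)
  simp [merge, heA, heB]

/-- A merge on `A` is the first configuration. -/
lemma merge_of_mem_left {A B : Finset E} {z x y : Config E} {e : E} (he : e ∈ A) :
    merge A B z x y e = x e := by
  simp [merge, he]

/-- A merge on `B` is the second configuration. -/
lemma merge_of_mem_right {A B : Finset E} (hAB : Disjoint A B) {z x y : Config E} {e : E}
    (he : e ∈ B) : merge A B z x y e = y e := by
  have heA : e ∉ A := fun h => Finset.disjoint_left.1 hAB h he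
  simp [merge, he, heA]

end Merge

section Sum

variable {E : Type*} [Fintype E] [DecidableEq E] {R : Type*} [AddCommMonoid R]

/-- **Reindexing a sum over configurations by merges**: a function vanishing off the configurations
agreeing with `z` off `A ∪ B` sums over merges of configurations agreeing with `z` off `A` and
off `B`. -/
theorem sum_merge (A B : Finset E) (hAB : Disjoint A B) (z : Config E) (g : Config E → R)
    (hg : ∀ x, ¬ (∀ e, e ∉ A ∪ B → x e = z e) → g x = 0) :
    ∑ x : Config E, g x = ∑ x1 : Config E, ∑ x2 : Config E,
      if (∀ e, e ∉ A → x1 e = z e) ∧ (∀ e, e ∉ B → x2 e = z e) then g (merge A B z x1 x2) else 0 := by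
  classical
  have hR : (∑ x1 : Config E, ∑ x2 : Config E,
      if (∀ e, e ∉ A → x1 e = z e) ∧ (∀ e, e ∉ B → x2 e = z e) then g (merge A B z x1 x2) else 0) =
      ∑ p ∈ (Finset.univ ×ˢ Finset.univ).filter
        (fun p : Config E × Config E => (∀ e, e ∉ A → p.1 e = z e) ∧ (∀ e, e ∉ B → p.2 e = z e)),
        g (merge A B z p.1 p.2) := by
    rw [Finset.sum_filter, Finset.sum_product]
  have hL : (∑ x : Config E, g x) =
      ∑ x ∈ Finset.univ.filter (fun x : Config E => ∀ e, e ∉ A ∪ B → x e = z e), g x := by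
    rw [Finset.sum_filter]
    refine Finset.sum_congr rfl fun x _ => ?_
    split_ifs with h
    · rfl
    · exact hg x h
  rw [hL, hR]
  refine Finset.sum_nbij' (fun x => (restr A z x, restr B z x)) (fun p => merge A B z p.1 p.2)
    ?_ ?_ ?_ ?_ ?_
  · intro x hx
    simp only [Finset.mem_filter, Finset.mem_univ, Finset.mem_product, true_and] at hx ⊢
    exact ⟨fun e he => restr_of_not_mem he, fun e he => restr_of_not_mem he⟩
  · rintro ⟨x1, x2⟩ hp
    simp only [Finset.mem_filter, Finset.mem_univ, Finset.mem_product, true_and] at hp ⊢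
    intro e he
    exact merge_agree e he
  · intro x hx
    simp only [Finset.mem_filter, Finset.mem_univ, true_and] at hx
    exact merge_restr hx
  · rintro ⟨x1, x2⟩ hp
    simp only [Finset.mem_filter, Finset.mem_univ, Finset.mem_product, true_and] at hp
    simp only [restr_merge_left hp.1, restr_merge_right hAB hp.2]
  · intro x hx
    simp only [Finset.mem_filter, Finset.mem_univ, true_and] at hx
    rw [merge_restr hx]

end Sum

section Factor

variable {E : Type*} [Fintype E] [DecidableEq E] {R : Type*} [CommRing R]

/-- The typed-triple condition on `A` for the three copies. -/
def cond (A : Finset E) (z : Config E) (τ : E → ℕ) (x y w : Config E) : Prop :=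
  (∀ e, e ∉ A → x e = z e ∧ y e = z e ∧ w e = z e) ∧ (∀ e ∈ A, openCount x y w e = τ e)

/-- The typed condition is decidable (the instance of `typedCount`). -/
instance cond.decidable (A : Finset E) (z : Config E) (τ : E → ℕ) (x y w : Config E) :
    Decidable (cond A z τ x y w) := by
  unfold cond
  infer_instance

omit [Fintype E] in
/-- The open count of merged copies on `A` is that of the first components. -/
lemma openCount_merge_left {A B : Finset E} {z : Config E} {x1 x2 y1 y2 w1 w2 : Config E} {e : E}
    (he : e ∈ A) :
    openCount (merge A B z x1 x2) (merge A B z y1 y2) (merge A B z w1 w2) e =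
      openCount x1 y1 w1 e := by
  simp [openCount, merge_of_mem_left he]

omit [Fintype E] in
/-- The open count of merged copies on `B` is that of the second components. -/
lemma openCount_merge_right {A B : Finset E} (hAB : Disjoint A B) {z : Config E}
    {x1 x2 y1 y2 w1 w2 : Config E} {e : E} (he : e ∈ B) :
    openCount (merge A B z x1 x2) (merge A B z y1 y2) (merge A B z w1 w2) e =
      openCount x2 y2 w2 e := by
  simp [openCount, merge_of_mem_right hAB he]

omit [Fintype E] in
/-- The typed condition on `A ∪ B` of a merged triple is the conjunction of the conditions on
`A` and on `B`. -/
lemma cond_merge {A B : Finset E} (hAB : Disjoint A B) {z : Config E} {τ : E → ℕ}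
    {x1 x2 y1 y2 w1 w2 : Config E} (hx1 : ∀ e, e ∉ A → x1 e = z e) (hy1 : ∀ e, e ∉ A → y1 e = z e)
    (hw1 : ∀ e, e ∉ A → w1 e = z e) (hx2 : ∀ e, e ∉ B → x2 e = z e)
    (hy2 : ∀ e, e ∉ B → y2 e = z e) (hw2 : ∀ e, e ∉ B → w2 e = z e) :
    cond (A ∪ B) z τ (merge A B z x1 x2) (merge A B z y1 y2) (merge A B z w1 w2) ↔
      cond A z τ x1 y1 w1 ∧ cond B z τ x2 y2 w2 := by
  unfold cond
  constructor
  · rintro ⟨_, h2⟩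
    refine ⟨⟨fun e he => ⟨hx1 e he, hy1 e he, hw1 e he⟩, fun e he => ?_⟩,
      ⟨fun e he => ⟨hx2 e he, hy2 e he, hw2 e he⟩, fun e he => ?_⟩⟩
    · rw [← openCount_merge_left (B := B) (z := z) (x2 := x2) (y2 := y2) (w2 := w2) he]
      exact h2 e (Finset.mem_union_left _ he)
    · rw [← openCount_merge_right hAB (z := z) (x1 := x1) (y1 := y1) (w1 := w1) he]
      exact h2 e (Finset.mem_union_right _ he)
  · rintro ⟨⟨_, hA⟩, ⟨_, hB⟩⟩
    refine ⟨fun e he => ⟨merge_agree e he, merge_agree e he, merge_agree e he⟩, fun e he => ?_⟩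
    rcases Finset.mem_union.1 he with heA | heB
    · rw [openCount_merge_left heA]; exact hA e heA
    · rw [openCount_merge_right hAB heB]; exact hB e heB

/-- The typed count as a sum of `cond`-indicators. -/
lemma typedCount_eq_sum_cond (A : Finset E) (z : Config E) (τ : E → ℕ)
    (K : Config E → Config E → Config E → R) :
    typedCount A z τ K = ∑ x : Config E, ∑ y : Config E, ∑ w : Config E,
      if cond A z τ x y w then K x y w else 0 := rfl

/-- **Factorisation of typed counts over disjoint typed-edge sets.** -/
theorem typedCount_mul_of_disjoint (A B : Finset E) (hAB : Disjoint A B) (z : Config E)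
    (τ : E → ℕ) (KA KB : Config E → Config E → Config E → R) :
    typedCount (A ∪ B) z τ (fun x y w =>
        KA (restr A z x) (restr A z y) (restr A z w) * KB (restr B z x) (restr B z y) (restr B z w)) =
      typedCount A z τ KA * typedCount B z τ KB := by
  classical
  rw [typedCount_eq_sum_cond, typedCount_eq_sum_cond, typedCount_eq_sum_cond]
  -- reindex the three sums by merges
  have hx := sum_merge (R := R) A B hAB z (fun x => ∑ y : Config E, ∑ w : Config E,
    if cond (A ∪ B) z τ x y w then
      KA (restr A z x) (restr A z y) (restr A z w) * KB (restr B z x) (restr B z y) (restr B z w)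
    else 0) (by
      intro x hxz
      refine Finset.sum_eq_zero fun y _ => Finset.sum_eq_zero fun w _ => ?_
      rw [if_neg]
      rintro ⟨h1, _⟩
      exact hxz fun e he => (h1 e he).1)
  rw [hx]
  simp only [Finset.sum_mul_sum]
  refine Finset.sum_congr rfl fun x1 _ => Finset.sum_congr rfl fun x2 _ => ?_
  by_cases hP1 : (∀ e, e ∉ A → x1 e = z e) ∧ (∀ e, e ∉ B → x2 e = z e)
  · rw [if_pos hP1]
    have hy := sum_merge (R := R) A B hAB z (fun y => ∑ w : Config E,
      if cond (A ∪ B) z τ (merge A B z x1 x2) y w then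
        KA (restr A z (merge A B z x1 x2)) (restr A z y) (restr A z w) *
          KB (restr B z (merge A B z x1 x2)) (restr B z y) (restr B z w)
      else 0) (by
        intro y hyz
        refine Finset.sum_eq_zero fun w _ => ?_
        rw [if_neg]
        rintro ⟨h1, _⟩
        exact hyz fun e he => (h1 e he).2.1)
    rw [hy]
    refine Finset.sum_congr rfl fun y1 _ => Finset.sum_congr rfl fun y2 _ => ?_
    by_cases hP2 : (∀ e, e ∉ A → y1 e = z e) ∧ (∀ e, e ∉ B → y2 e = z e)
    · rw [if_pos hP2]
      have hw := sum_merge (R := R) A B hAB z (fun w =>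
        if cond (A ∪ B) z τ (merge A B z x1 x2) (merge A B z y1 y2) w then
          KA (restr A z (merge A B z x1 x2)) (restr A z (merge A B z y1 y2)) (restr A z w) *
            KB (restr B z (merge A B z x1 x2)) (restr B z (merge A B z y1 y2)) (restr B z w)
        else 0) (by
          intro w hwz
          rw [if_neg]
          rintro ⟨h1, _⟩
          exact hwz fun e he => (h1 e he).2.2)
      rw [hw]
      refine Finset.sum_congr rfl fun w1 _ => Finset.sum_congr rfl fun w2 _ => ?_
      by_cases hP3 : (∀ e, e ∉ A → w1 e = z e) ∧ (∀ e, e ∉ B → w2 e = z e)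
      · rw [if_pos hP3, restr_merge_left hP1.1, restr_merge_left hP2.1, restr_merge_left hP3.1,
          restr_merge_right hAB hP1.2, restr_merge_right hAB hP2.2, restr_merge_right hAB hP3.2]
        rw [if_congr (cond_merge hAB hP1.1 hP2.1 hP3.1 hP1.2 hP2.2 hP3.2) rfl rfl]
        by_cases hA : cond A z τ x1 y1 w1
        · by_cases hB : cond B z τ x2 y2 w2
          · rw [if_pos ⟨hA, hB⟩, if_pos hA, if_pos hB]
          · rw [if_neg (fun h => hB h.2), if_neg hB, mul_zero]
        · rw [if_neg (fun h => hA h.1), if_neg hA, zero_mul]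
      · rw [if_neg hP3]
        rw [not_and_or] at hP3
        rcases hP3 with h | h
        · rw [if_neg (c := cond A z τ x1 y1 w1) (fun hc => h fun e he => (hc.1 e he).2.2), zero_mul]
        · rw [if_neg (c := cond B z τ x2 y2 w2) (fun hc => h fun e he => (hc.1 e he).2.2), mul_zero]
    · rw [if_neg hP2]
      rw [not_and_or] at hP2
      symm
      refine Finset.sum_eq_zero fun w1 _ => Finset.sum_eq_zero fun w2 _ => ?_
      rcases hP2 with h | h
      · rw [if_neg (c := cond A z τ x1 y1 w1) (fun hc => h fun e he => (hc.1 e he).2.1), zero_mul]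
      · rw [if_neg (c := cond B z τ x2 y2 w2) (fun hc => h fun e he => (hc.1 e he).2.1), mul_zero]
  · rw [if_neg hP1]
    rw [not_and_or] at hP1
    symm
    refine Finset.sum_eq_zero fun y1 _ => Finset.sum_eq_zero fun y2 _ =>
      Finset.sum_eq_zero fun w1 _ => Finset.sum_eq_zero fun w2 _ => ?_
    rcases hP1 with h | h
    · rw [if_neg (c := cond A z τ x1 y1 w1) (fun hc => h fun e he => (hc.1 e he).1), zero_mul]
    · rw [if_neg (c := cond B z τ x2 y2 w2) (fun hc => h fun e he => (hc.1 e he).1), mul_zero]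

end Factor

end TypedFactor

end CovForm

end Summit.Ventures.PercRepro2
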